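import Summits.BirchSwinnertonDyer.BirchSwinnertonDyer.Theorems.AlignedTransportAtTwoMainConjectureOfRankZeroBSDAtTwoFineRoadKleinExtension
import HarnessLib

/-!
# Route `AlignedTransportAtTwo`, crux C2 `MainConjectureOfRankZeroBSDAtTwo` (stmt-BirchSwinnertonDyer-22298),
# road (b″): PERFECT DESCENT at `2`, part IV — `H²(Q̄, V₄) = 0` for `Q̄ ∈ {C₃, S₃}` and the full EXTENSION
# theorem: every equivariant homomorphism on the kernel of the action extends to a crossed homomorphism

Cell `bsd-f1-sign2`, WIDTH-5 attach seat `bsd-line-att-p3` (gen 4) on line `birth` of crux C2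
(`--supports` stmt-BirchSwinnertonDyer-22298; closes nothing). HONEST FRAMING: THEOREMS ONLY — no definition, no
named fact, no instance, no `sorry`; BSD is NOT proved by any of this. Sequel of `…FineRoadKleinCohomology`
(`H¹ = 0`) and `…FineRoadKleinExtension` (transversal lemma, `Q̄ ∈ {1, C₂, C₃}`). Setting as there: a group `Q`
acting on `M` (`#M = 4`, `m + m = 0`), `N` = kernel of the action, `φ : Q → M` additive and `Q`-equivariant on `N`.

## What is proved

* **`exists_crossedHom_extension_of_fpf`** (`Q` has a fixed-point-free element `σ`, i.e. `Q̄ ∈ {C₃, S₃}`): some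
  crossed homomorphism `A : Q → M` restricts to `φ` on `N`. TWO STEPS: (1) the elements acting trivially or without
  non-zero fixed point form a subgroup `Q₃` (index `≤ 2`, the preimage of `A₃`; closure by `fpf_smul_dichotomy`),
  on which `…of_fpf_of_no_transposition` extends `φ` to a crossed homomorphism `ψ₃`; (2) for `g ∈ Q` the map
  `x ↦ g • ψ₃(g⁻¹ x g) - ψ₃ x` is a crossed homomorphism on `Q₃` vanishing on `N`, hence PRINCIPAL by part I
  (`klein_crossedHom_principal`, `H¹ = 0`), `= x • a_g - a_g` with `a_g` UNIQUE (`M^{σ} = 0`); `g ↦ a_g` is a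
  crossed homomorphism on `Q` extending `ψ₃` (the index-`2` step of att-p4's `…FineRoadInfResSurj`, done on
  cocycles so that no normality inside an ambient group is needed).
* **`exists_crossedHom_extension`** (no hypothesis on the image `Q̄ ≤ Aut(M) ≅ S₃`): every `φ : Q → M` additive
  and `Q`-equivariant on the kernel `N` of the action is the restriction of a crossed homomorphism on `Q` — the
  vanishing of the transgression `H¹(N, M)^{Q} → H²(Q/N, M)`, i.e. `H²(Q̄, V₄) = 0` for every `Q̄ ≤ S₃` in the form
  the descent uses (PERFECT-DESCENT.md §2–§3 (ii), lead att-p2 g4: `E[2]` is `𝔽₂[S₃]`-projective).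

The Galois / topological packaging (`res : H¹(H, E[2]) → H¹(H ⊓ ker ρ̄_{E,2}, E[2])^{H}` is ONTO for every
`H ≤ Γ_K`, continuity being automatic because `ker ρ̄` is open) is the sequel `…FineRoadPerfectDescentSurj`.

References: J.-P. Serre, *Galois Cohomology*, I §2.6 (b) (the five-term sequence), I §5.1, I §5.8;
K. S. Brown, *Cohomology of Groups*, VI.8; Neukirch–Schmidt–Wingberg, (1.6.7).
-/

set_option autoImplicit false
-- the Theorems namespace of this sub repeats the summit name by design (D-0017 nested layout)
set_option linter.dupNamespace false

namespace Summit.BirchSwinnertonDyer.BirchSwinnertonDyer.Theorems.AlignedTransportAtTwoFineRoad.PerfectDescent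

open Summit.BirchSwinnertonDyer.BirchSwinnertonDyer.Theorems.MultTransportAtTwo

variable {Q : Type*} [Group Q] {M : Type*} [AddCommGroup M] [DistribMulAction Q M]

/-! ## §1 Closure properties of «acts trivially or without non-zero fixed point» -/

section Closure

/-- Products of two elements each acting trivially or fixed-point-freely act trivially or fixed-point-freely
(`{1} ∪ {3-cycles} = A₃` is a subgroup; the mixed case by `fpf_smul_dichotomy`). [folklore] -/
theorem trivOrFpf_mul (h4 : Nat.card M = 4) (h2 : ∀ m : M, m + m = 0) {g h : Q}
    (hg : (∀ m : M, g • m = m) ∨ (∀ m : M, g • m = m → m = 0))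
    (hh : (∀ m : M, h • m = m) ∨ (∀ m : M, h • m = m → m = 0)) :
    (∀ m : M, (g * h) • m = m) ∨ (∀ m : M, (g * h) • m = m → m = 0) := by
  rcases hg with hg | hg <;> rcases hh with hh | hh
  · exact Or.inl fun m ↦ by rw [mul_smul, hh, hg]
  · exact Or.inr fun m hm ↦ hh m (by rw [mul_smul, hg] at hm; exact hm)
  · exact Or.inr fun m hm ↦ hg m (by rw [mul_smul, hh] at hm; exact hm)
  · rcases fpf_smul_dichotomy h4 h2 hg hh with e | e
    · refine Or.inr fun m hm ↦ ?_
      rw [mul_smul, e, smul_smul_eq_add_of_fpf h4 h2 hg] at hm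
      exact (smul_eq_zero_iff_eq g).mp (by simpa using hm)
    · exact Or.inl fun m ↦ by rw [mul_smul, e, smul_smul_smul_eq_self_of_fpf h4 h2 hg]

/-- Inverses preserve «trivial or fixed-point-free». [folklore] -/
theorem trivOrFpf_inv {g : Q} (hg : (∀ m : M, g • m = m) ∨ (∀ m : M, g • m = m → m = 0)) :
    (∀ m : M, g⁻¹ • m = m) ∨ (∀ m : M, g⁻¹ • m = m → m = 0) := by
  rcases hg with hg | hg
  · exact Or.inl fun m ↦ by conv_lhs => rw [← hg m]; rw [inv_smul_smul]
  · refine Or.inr fun m hm ↦ hg m ?_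
    have e := congrArg (fun x ↦ g • x) hm
    simp only [smul_inv_smul] at e
    exact e.symm

/-- Conjugates preserve «trivial or fixed-point-free». [folklore] -/
theorem trivOrFpf_conj {x : Q} (hx : (∀ m : M, x • m = m) ∨ (∀ m : M, x • m = m → m = 0)) (g : Q) :
    (∀ m : M, (g⁻¹ * x * g) • m = m) ∨ (∀ m : M, (g⁻¹ * x * g) • m = m → m = 0) := by
  rcases hx with hx | hx
  · refine Or.inl fun m ↦ ?_
    have h := conj_smul_eq_self_of_smul_eq_self hx g⁻¹ m
    rwa [inv_inv] at h
  · refine Or.inr fun m hm ↦ ?_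
    rw [mul_smul, mul_smul] at hm
    have e : x • (g • m) = g • m := by
      have e' := congrArg (fun y ↦ g • y) hm
      simp only [smul_inv_smul] at e'
      exact e'
    exact (smul_eq_zero_iff_eq g).mp (hx _ e)

end Closure

/-! ## §2 `Q̄ ∈ {C₃, S₃}`: the two-step extension -/

section Fpf

/-- **Extension across `Q̄ ∈ {C₃, S₃}`.** Let `Q` act on the Klein four-group `M` with a fixed-point-free element
`σ`, `N` = kernel of the action, `φ : Q → M` additive and `Q`-equivariant on `N`. Then some crossed homomorphism
`A : Q → M` restricts to `φ` on `N`. Step 1: on the subgroup `Q₃ = {trivial or fixed-point-free}` extend by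
`exists_crossedHom_extension_of_fpf_of_no_transposition` to `ψ₃`. Step 2: for each `g ∈ Q` the crossed homomorphism
`x ↦ g • ψ₃(g⁻¹ x g) - ψ₃(x)` on `Q₃` vanishes on `N`, so equals `x • a_g - a_g` (`klein_crossedHom_principal`) for a
unique `a_g` (`M^{σ} = 0`); `A := (g ↦ a_g)`. [cite: SerreGaloisCohomology1997, I §2.6 (b)]
[cite: NeukirchSchmidtWingberg2008, I.§6 Prop. 1.6.7] -/
theorem exists_crossedHom_extension_of_fpf (h4 : Nat.card M = 4) (h2 : ∀ m : M, m + m = 0)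
    (N : Subgroup Q) (hN : ∀ g : Q, g ∈ N ↔ ∀ m : M, g • m = m) {σ : Q}
    (hσ : ∀ m : M, σ • m = m → m = 0) (φ : Q → M) (hφ : ∀ x ∈ N, ∀ y ∈ N, φ (x * y) = φ x + φ y)
    (hφeq : ∀ (g : Q), ∀ x ∈ N, φ (g * x * g⁻¹) = g • φ x) :
    ∃ A : Q → M, (∀ g h : Q, A (g * h) = A g + g • A h) ∧ ∀ n ∈ N, A n = φ n := by
  have hNtriv : ∀ n ∈ N, ∀ m : M, n • m = m := fun n hn ↦ (hN n).mp hn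
  -- Step 0: the subgroup `Q₃` of elements acting trivially or without non-zero fixed point
  let Q₃ : Subgroup Q :=
    { carrier := {g | (∀ m : M, g • m = m) ∨ (∀ m : M, g • m = m → m = 0)}
      one_mem' := Or.inl fun m ↦ one_smul Q m
      mul_mem' := fun hg hh ↦ trivOrFpf_mul h4 h2 hg hh
      inv_mem' := fun hg ↦ trivOrFpf_inv hg }
  have hmemQ₃ : ∀ g : Q, g ∈ Q₃ ↔ (∀ m : M, g • m = m) ∨ (∀ m : M, g • m = m → m = 0) := fun _ ↦ Iff.rfl
  have hNQ₃ : ∀ n ∈ N, n ∈ Q₃ := fun n hn ↦ (hmemQ₃ n).mpr (Or.inl (hNtriv n hn))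
  -- Step 1: extend `φ` over `Q₃` (its image is `1` or `C₃`)
  obtain ⟨ψ₃, hψ₃, hψ₃N⟩ : ∃ ψ₃ : Q₃ → M, (∀ x y : Q₃, ψ₃ (x * y) = ψ₃ x + x • ψ₃ y) ∧
      ∀ x : Q₃, (x : Q) ∈ N → ψ₃ x = φ x := by
    obtain ⟨ψ₃, hψ₃, hψ₃N⟩ := exists_crossedHom_extension_of_fpf_of_no_transposition (Q := Q₃) h4 h2
      (N.subgroupOf Q₃) (fun x ↦ by rw [Subgroup.mem_subgroupOf]; exact hN x) (σ := ⟨σ, Or.inr hσ⟩)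
      (fun m hm ↦ hσ m hm) (fun x ↦ x.2) (fun x ↦ φ x)
      (fun x hx y hy ↦ hφ x (Subgroup.mem_subgroupOf.mp hx) y (Subgroup.mem_subgroupOf.mp hy))
      (fun g x hx ↦ hφeq g x (Subgroup.mem_subgroupOf.mp hx))
    exact ⟨ψ₃, hψ₃, fun x hx ↦ hψ₃N x (Subgroup.mem_subgroupOf.mpr hx)⟩
  -- Step 2: the conjugate-difference crossed homomorphisms on `Q₃`
  have hconj : ∀ (g : Q) (x : Q₃), g⁻¹ * (x : Q) * g ∈ Q₃ := fun g x ↦ trivOrFpf_conj x.2 g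
  have key : ∀ g : Q, ∃ a : M, ∀ x : Q₃,
      g • ψ₃ ⟨g⁻¹ * x * g, hconj g x⟩ - ψ₃ x = (x : Q) • a - a := by
    intro g
    set D : Q₃ → M := fun x ↦ g • ψ₃ ⟨g⁻¹ * x * g, hconj g x⟩ - ψ₃ x with hDdef
    have hD : ∀ x y : Q₃, D (x * y) = D x + x • D y := by
      intro x y
      have e : (⟨g⁻¹ * ((x * y : Q₃) : Q) * g, hconj g (x * y)⟩ : Q₃) =
          ⟨g⁻¹ * x * g, hconj g x⟩ * ⟨g⁻¹ * y * g, hconj g y⟩ :=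
        Subtype.ext (by simp only [Subgroup.coe_mul]; group)
      simp only [hDdef]
      rw [e, hψ₃, hψ₃]
      simp only [Subgroup.smul_def, smul_add, smul_sub, smul_smul]
      rw [show g * (g⁻¹ * ↑x * g) = ↑x * g by group]
      abel
    have hDker : ∀ x : Q₃, (∀ m : M, x • m = m) → D x = 0 := by
      intro x hx
      have hxN : (x : Q) ∈ N := (hN x).mpr fun m ↦ by rw [← Subgroup.smul_def]; exact hx m
      have hcN : g⁻¹ * (x : Q) * g ∈ N := by
        have h := (hN _).mpr (conj_smul_eq_self_of_smul_eq_self (hNtriv _ hxN) g⁻¹)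
        rwa [inv_inv] at h
      simp only [hDdef]
      rw [hψ₃N x hxN, hψ₃N ⟨g⁻¹ * x * g, hconj g x⟩ hcN]
      change g • φ (g⁻¹ * (x : Q) * g) - φ x = 0
      have e := hφeq g⁻¹ x hxN
      rw [inv_inv] at e
      rw [e, smul_inv_smul, sub_self]
    exact klein_crossedHom_principal h4 h2 D hD hDker
  choose A hA using key
  -- uniqueness of the boundary (`M^{σ} = 0`)
  have huniq : ∀ a a' : M, (∀ x : Q₃, (x : Q) • a - a = (x : Q) • a' - a') → a = a' := by
    intro a a' h
    have e := h ⟨σ, Or.inr hσ⟩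
    rw [sub_eq_sub_iff_sub_eq_sub, ← smul_sub] at e
    exact sub_eq_zero.mp (hσ _ e)
  -- (P1) `A` extends `ψ₃`
  have hA1 : ∀ k : Q₃, A k = ψ₃ k := by
    intro k
    apply huniq
    intro x
    rw [← hA k x]
    have e : (⟨(k : Q)⁻¹ * x * k, hconj k x⟩ : Q₃) = k⁻¹ * x * k := Subtype.ext rfl
    have h1 : ψ₃ (x * k) = ψ₃ x + (x : Q) • ψ₃ k := by rw [hψ₃, Subgroup.smul_def]
    have h2' : ψ₃ (k * (k⁻¹ * x * k)) = ψ₃ k + (k : Q) • ψ₃ (k⁻¹ * x * k) := by rw [hψ₃, Subgroup.smul_def]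
    rw [show k * (k⁻¹ * x * k) = x * k by group, h1] at h2'
    rw [e, eq_sub_of_add_eq' h2'.symm]
    abel
  -- (P2) `A` is a crossed homomorphism on `Q`
  have hA2 : ∀ g g' : Q, A (g * g') = A g + g • A g' := by
    intro g g'
    apply huniq
    intro x
    rw [← hA (g * g') x]
    set y : Q₃ := ⟨g⁻¹ * x * g, hconj g x⟩ with hy
    have e1 : (⟨(g * g')⁻¹ * (x : Q) * (g * g'), hconj (g * g') x⟩ : Q₃) = ⟨g'⁻¹ * y * g', hconj g' y⟩ :=
      Subtype.ext (by simp only [hy]; group)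
    have h1 : g • ψ₃ y - ψ₃ x = (x : Q) • A g - A g := hA g x
    have h2' : g' • ψ₃ ⟨g'⁻¹ * y * g', hconj g' y⟩ - ψ₃ y = (y : Q) • A g' - A g' := hA g' y
    have hyx : g * (y : Q) = (x : Q) * g := by simp only [hy]; group
    rw [e1, mul_smul, eq_add_of_sub_eq' h2', smul_add, smul_sub, smul_smul, hyx, eq_add_of_sub_eq' h1,
      smul_add, mul_smul]
    abel
  refine ⟨A, hA2, fun n hn ↦ ?_⟩
  rw [show A n = A ((⟨n, hNQ₃ n hn⟩ : Q₃) : Q) from rfl, hA1, hψ₃N _ hn]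

end Fpf

/-! ## §3 The extension theorem for every image `Q̄ ≤ Aut(V₄) ≅ S₃` -/

section All

/-- **`H²(Q̄, V₄) = 0` as an extension theorem, for every faithful image `Q̄ ≤ S₃`.** Let a group `Q` act on an
additive group `M` with four elements and `m + m = 0`, let `N ≤ Q` be the kernel of the action, and let
`φ : Q → M` be additive on `N` and `Q`-equivariant on `N` (`φ (g x g⁻¹) = g • φ x`; i.e. a `Q`-invariant
homomorphism `N → M`). Then `φ|_N` is the restriction of a crossed homomorphism `A : Q → M`
(`A (g h) = A g + g • A h`). With `klein_crossedHom_principal` (uniqueness up to principal crossed homomorphisms)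
this is the exactness of `0 → H¹(Q, M) → Hom_Q(N, M) → 0`: PERFECT DESCENT for the Steinberg module of
`GL₂(𝔽₂)`. [cite: SerreGaloisCohomology1997, I §2.6 (b)] [cite: NeukirchSchmidtWingberg2008, I.§6 Prop. 1.6.7] -/
theorem exists_crossedHom_extension (h4 : Nat.card M = 4) (h2 : ∀ m : M, m + m = 0) (N : Subgroup Q)
    (hN : ∀ g : Q, g ∈ N ↔ ∀ m : M, g • m = m) (φ : Q → M)
    (hφ : ∀ x ∈ N, ∀ y ∈ N, φ (x * y) = φ x + φ y) (hφeq : ∀ (g : Q), ∀ x ∈ N, φ (g * x * g⁻¹) = g • φ x) :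
    ∃ A : Q → M, (∀ g h : Q, A (g * h) = A g + g • A h) ∧ ∀ n ∈ N, A n = φ n := by
  by_cases hA : ∃ σ : Q, ∀ m : M, σ • m = m → m = 0
  · obtain ⟨σ, hσ⟩ := hA
    exact exists_crossedHom_extension_of_fpf h4 h2 N hN hσ φ hφ hφeq
  · push Not at hA
    exact exists_crossedHom_extension_of_no_fpf h4 h2 N hN hA φ hφ hφeq

/-- **Uniqueness up to principal crossed homomorphisms** (restatement of part I for extensions): two crossed
homomorphisms `A, A' : Q → M` agreeing on the kernel `N` of the action differ by a principal one,
`A' g = A g + (g • a - a)`. [cite: SerreGaloisCohomology1997, I §5.1] -/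
theorem crossedHom_extension_unique (h4 : Nat.card M = 4) (h2 : ∀ m : M, m + m = 0) (N : Subgroup Q)
    (hN : ∀ g : Q, g ∈ N ↔ ∀ m : M, g • m = m) {A A' : Q → M}
    (hA : ∀ g h : Q, A (g * h) = A g + g • A h) (hA' : ∀ g h : Q, A' (g * h) = A' g + g • A' h)
    (hagree : ∀ n ∈ N, A n = A' n) : ∃ a : M, ∀ g : Q, A' g = A g + (g • a - a) := by
  obtain ⟨a, ha⟩ := klein_crossedHom_principal h4 h2 (fun g ↦ A' g - A g)
    (fun g h ↦ by rw [hA, hA', smul_sub]; abel) (fun g hg ↦ by rw [hagree g ((hN g).mpr hg), sub_self])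
  exact ⟨a, fun g ↦ by rw [← ha g]; abel⟩

end All

end Summit.BirchSwinnertonDyer.BirchSwinnertonDyer.Theorems.AlignedTransportAtTwoFineRoad.PerfectDescent
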